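import Summits.QuantumFields.YangMills.Theorems.BalabanLadderIRcofEquipartitionSeamOperatorForm
import Mathlib.Analysis.CStarAlgebra.Matrix
import Literature.MathematicalPhysics.QuantumLattice.TraceInequalitiesProofs
import HarnessLib

/-!
# Equipartition seam, §6: operator norm ⇒ numerical radius; rank-one deflation ⇒ «sector mean = vacuum element up to
# the sector's cold pressure» — the typed hook from the centre-Fourier engine to row 39's light-code token

Helper for crux `IRcof` (stmt-QuantumFields-26930), N_cof side — the sorry-free §6 of ideator ym-ir-idea-22's LINE 1
«equipartition-seam» rev 3 (`Cruxes/IRcof/Lines/equipartition_seam.lean`, crux write 5ee1c21243cb; crit-3 verdict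
PASS-WITH-PRICE row 47, 20:12:53Z), offered to the custody LEAD's landing lane (`--supports stmt-QuantumFields-26930 --as helper`).
Mathematics = matrix analysis over `Matrix n n ℂ` (no lattice object, no definition, no named fact):

* (tree, cited by name: `Literature.MathematicalPhysics.QuantumLattice.norm_star_dotProduct_mulVec_le`, `TraceInequalitiesProofs`) — for the ℓ²-operator norm (scoped `Matrix.Norms.L2Operator`), `‖⟨v, K v⟩‖ ≤ ‖K‖ ⟨v, v⟩`: EVERY matrix meets the
  numerical-radius hypothesis of `norm_trace_mul_le_of_quadForm` ∕ `centreFourier_traceBlindness_quadForm` (p664144) with `a = ‖K‖`;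
  corollaries `norm_trace_mul_le_opNorm`, `centreFourier_traceBlindness_opNorm` (the engine p164278 with NO hypothesis on the observable).
* `posSemidef_sub_eigenProj` — `B ⪰ 0`, `B e = θ e`, `⟨e, e⟩ = 1` ⇒ `B − θ|e⟩⟨e| ⪰ 0` (congruence by `1 − |e⟩⟨e|`).
* `norm_trace_mul_sub_eigen_le` (+ `_opNorm`) — `‖tr(B K) − θ ⟨e, K e⟩‖ ≤ a · (Re tr B − θ)`; `eigen_le_trace_re` — `θ ≤ Re tr B`.

Reading (row 39, `FluxCodeBlindness.LightCodeModel`, `Theorems/BalabanLadderIRLightCodeDefs.lean`): `B = P_k 𝕋^w` (a flux-sector block of a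
transfer power), `e = e k` (sector vacuum), `θ = θ_k^w`, `K` = slab operator of the species; `Re tr B − θ = Σ_{j≥1} λ_{k,j}^w` is the sector's
cold-pressure excess.  So the light-code DIAGONAL clause `|⟪e k, A∘(e k)⟫ − ⟪e 0, A∘(e 0)⟫ θ_k^w| ≤ εc` follows, at matrix level, from twist
EQUIPARTITION (engine) + per-sector cold pressure; the frame rotation between the two transfer readings is a lattice identity, not treated here.

HONEST FRAMING: finite-dimensional operator bookkeeping (width 0); nothing here proves N_cof, PXcof, `IRcof`, `IR`, or the Clay Yang–Mills
mass gap (NOT proved anywhere in this tree; R4 = the conditional finite-𝕋⁴ rung `BalabanLadder.UV` only).  Attribution: ym-ir-idea-22 g3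
(author); p164278 (engine), p664144 (operator form).  LANDING NOTE (custody LEAD ym-ir-line-ab-p1 g7, gate-forced only): the offered
`quadForm_of_l2OpNorm` restated the tree's `norm_star_dotProduct_mulVec_le` (dedup.landed) and is replaced by that name; nothing else changed.
-/

set_option autoImplicit false

noncomputable section

namespace Summit.QuantumFields.YangMills.Theorems.NonSimplyConnectedLatticeGap

section CodeHook

open scoped ComplexOrder MatrixOrder Matrix.Norms.L2Operator InnerProductSpace
open Matrix WithLp
open Literature.MathematicalPhysics.QuantumLattice (norm_star_dotProduct_mulVec_le)

variable {n : Type*} [Fintype n] [DecidableEq n]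

/-- The trace inequality (§5, landed) with the operator norm: `B ⪰ 0 ⇒ ‖tr (B K)‖ ≤ ‖K‖ · Re tr B`. -/
theorem norm_trace_mul_le_opNorm {B : Matrix n n ℂ} (hB : B.PosSemidef) (K : Matrix n n ℂ) :
    ‖(B * K).trace‖ ≤ ‖K‖ * B.trace.re :=
  norm_trace_mul_le_of_quadForm hB (norm_star_dotProduct_mulVec_le K)

/-- **Rank-one deflation of a PSD matrix along a unit eigenvector.**  If `B ⪰ 0`, `B e = θ e` with `θ` real and
`⟨e, e⟩ = 1`, then `B − θ |e⟩⟨e| ⪰ 0`.  Proof: `B − θ|e⟩⟨e| = (1 − |e⟩⟨e|)ᴴ B (1 − |e⟩⟨e|)` (the projector commutes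
with `B` because `e` is an eigenvector of the Hermitian `B`), and congruence preserves positivity
(`Matrix.PosSemidef.conjTranspose_mul_mul_same`).  Reading: `B = P_ψ 𝕋^w` (a flux-sector block of a transfer
power), `e = Ω_ψ` the sector vacuum, `θ = θ_ψ^w`. -/
theorem posSemidef_sub_eigenProj {B : Matrix n n ℂ} (hB : B.PosSemidef) {e : n → ℂ} {θ : ℝ}
    (he : B *ᵥ e = (θ : ℂ) • e) (hunit : star e ⬝ᵥ e = 1) :
    (B - (θ : ℂ) • vecMulVec e (star e)).PosSemidef := by
  set P : Matrix n n ℂ := vecMulVec e (star e) with hPdef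
  have hPH : Pᴴ = P := by rw [hPdef, conjTranspose_vecMulVec, star_star]
  have hBP : B * P = (θ : ℂ) • P := by
    rw [hPdef, mul_vecMulVec, he, smul_vecMulVec]
  have hPB : P * B = (θ : ℂ) • P := by
    have h := congrArg conjTranspose hBP
    rw [conjTranspose_mul, hPH, hB.isHermitian.eq, conjTranspose_smul, hPH] at h
    rw [h, Complex.star_def, Complex.conj_ofReal]
  have hPP : P * P = P := by
    rw [hPdef, vecMulVec_mul_vecMulVec, hunit, one_smul]
  have hkey : (1 - P)ᴴ * B * (1 - P) = B - (θ : ℂ) • P := by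
    rw [conjTranspose_sub, conjTranspose_one, hPH]
    have h4 : ((1 : Matrix n n ℂ) - P) * B * (1 - P) = B - B * P - P * B + P * B * P := by
      noncomm_ring
    rw [h4, hPB, Matrix.smul_mul, hPP, hBP]
    abel
  rw [← hkey]
  exact hB.conjTranspose_mul_mul_same (1 - P)

/-- **Sector mean vs vacuum matrix element (the diagonal code hook).**  If `B ⪰ 0` has the unit eigenvector `e`
with eigenvalue `θ` and `K` has numerical radius `≤ a`, then
`‖tr (B K) − θ ⟨e, K e⟩‖ ≤ a · (Re tr B − θ)`.
Reading (row 39 / `FluxCodeBlindness.LightCodeModel`): with `B = P_ψ 𝕋^w`, `e = Ω_ψ`, `θ = θ_ψ^w` and `K = K_A` a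
slab operator, `tr (B K)` is the un-normalised flux-sector mean of the species and `Re tr B − θ = Σ_{j ≥ 1} λ_{ψ,j}^w`
is the sector's COLD-PRESSURE excess (`secExcess` / `LightMultipletPressureAt` currency); so per sector
`|⟨Ω_ψ, K_A Ω_ψ⟩ θ_ψ^w − tr(P_ψ 𝕋^w K_A)| ≤ a · excess_ψ(w)`.  Combined with the equipartition engine
(`centreFourier_traceBlindness_quadForm`: sector means agree up to `(2|Γ|+1) a δ`), this is the DIAGONAL clause
`|⟪e k, A∘ (e k)⟫ − ⟪e 0, A∘ (e 0)⟫ θ_k^w| ≤ εc` of `LightCodeModel` with `εc` = O(equipartition defect δ + sector cold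
pressure) — i.e. row 39's BLINDᴷ′ diagonal input FOLLOWS from S3 (EQUI) + wall-1 sector pressure, modulo the
lattice↔transfer dictionary (stub S4's X5 frame rotation, not a matrix fact). -/
theorem norm_trace_mul_sub_eigen_le {B K : Matrix n n ℂ} {a θ : ℝ} (hB : B.PosSemidef) {e : n → ℂ}
    (he : B *ᵥ e = (θ : ℂ) • e) (hunit : star e ⬝ᵥ e = 1)
    (hK : ∀ v : n → ℂ, ‖star v ⬝ᵥ (K *ᵥ v)‖ ≤ a * (star v ⬝ᵥ v).re) :
    ‖(B * K).trace - θ * (star e ⬝ᵥ (K *ᵥ e))‖ ≤ a * (B.trace.re - θ) := by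
  have h := norm_trace_mul_le_of_quadForm (posSemidef_sub_eigenProj hB he hunit) hK
  have htrPK : (vecMulVec e (star e) * K).trace = star e ⬝ᵥ (K *ᵥ e) := by
    rw [← trace_mul_comm, mul_vecMulVec, trace_vecMulVec, dotProduct_comm]
  have htrP : (vecMulVec e (star e)).trace = 1 := by
    rw [trace_vecMulVec, dotProduct_comm, hunit]
  rw [sub_mul, Matrix.smul_mul, trace_sub, trace_smul, htrPK, smul_eq_mul, trace_sub, trace_smul, htrP,
    smul_eq_mul, mul_one, Complex.sub_re, Complex.ofReal_re] at h
  exact h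

/-- Operator-norm form of the diagonal code hook: `‖tr (B K) − θ ⟨e, K e⟩‖ ≤ ‖K‖ · (Re tr B − θ)`. -/
theorem norm_trace_mul_sub_eigen_le_opNorm {B : Matrix n n ℂ} {θ : ℝ} (hB : B.PosSemidef) {e : n → ℂ}
    (he : B *ᵥ e = (θ : ℂ) • e) (hunit : star e ⬝ᵥ e = 1) (K : Matrix n n ℂ) :
    ‖(B * K).trace - θ * (star e ⬝ᵥ (K *ᵥ e))‖ ≤ ‖K‖ * (B.trace.re - θ) :=
  norm_trace_mul_sub_eigen_le hB he hunit (norm_star_dotProduct_mulVec_le K)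

/-- The excess `Re tr B − θ` in the hook is non-negative (it is the trace of the PSD deflation). -/
theorem eigen_le_trace_re {B : Matrix n n ℂ} (hB : B.PosSemidef) {e : n → ℂ} {θ : ℝ}
    (he : B *ᵥ e = (θ : ℂ) • e) (hunit : star e ⬝ᵥ e = 1) : θ ≤ B.trace.re := by
  have h := (Complex.nonneg_iff.mp (posSemidef_sub_eigenProj hB he hunit).trace_nonneg).1
  have htrP : (vecMulVec e (star e)).trace = 1 := by
    rw [trace_vecMulVec, dotProduct_comm, hunit]
  rw [trace_sub, trace_smul, htrP, smul_eq_mul, mul_one, Complex.sub_re, Complex.ofReal_re] at h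
  linarith

end CodeHook

section EngineOpNorm

open scoped ComplexOrder MatrixOrder Matrix.Norms.L2Operator
open Matrix
open Literature.MathematicalPhysics.QuantumLattice (norm_star_dotProduct_mulVec_le)

variable {n : Type} [Fintype n] [DecidableEq n]
variable {α : Type} [AddCommGroup α] [Fintype α] [DecidableEq α]

/-- **Abstract electric blindness, operator-norm form** (no hypothesis on the observable at all):
`centreFourier_traceBlindness_quadForm` with `a = ‖A‖`.  Any slab operator of any (multi-slice, non-Hermitian)
species qualifies. -/
theorem centreFourier_traceBlindness_opNorm (U : α → Matrix n n ℂ) (X A : Matrix n n ℂ) (δ : ℝ)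
    (hU0 : U 0 = 1) (hUadd : ∀ x y : α, U (x + y) = U x * U y) (hUstar : ∀ x : α, (U x)ᴴ = U (-x))
    (hX : X.PosSemidef) (hUX : ∀ x : α, U x * X = X * U x) (hδ : 0 ≤ δ)
    (hequi : ∀ x : α, ‖(U x * X).trace - X.trace‖ ≤ δ * X.trace.re) (x : α) :
    ‖(U x * X * A).trace * X.trace - (X * A).trace * (U x * X).trace‖
      ≤ (2 * (Fintype.card α : ℝ) + 1) * ‖A‖ * δ * X.trace.re ^ 2 :=
  centreFourier_traceBlindness_quadForm n α U X A ‖A‖ δ hU0 hUadd hUstar hX hUX (norm_nonneg A)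
    (norm_star_dotProduct_mulVec_le A) hδ hequi x

end EngineOpNorm

end Summit.QuantumFields.YangMills.Theorems.NonSimplyConnectedLatticeGap

end
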